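import Summits.ValiantsHypothesis.ValiantsHypothesis.Theorems.FifoMatchingNNNotVPSpreadCofactorIffExpHard
import Literature.Computability.AlgebraicComplexity.StrassenDivisionElimination

/-!
# Crux `FifoMatching.NNNotVP` (stmt-ValiantsHypothesis-11615), line `division_split`: the registered
stub B2 `stub_spreadCofactorReduction` is implied by the EXPONENTIAL general hardness of `NN`

Helper toward item stmt-ValiantsHypothesis-11615 (`--supports`).  Hand 8 classified the registered
open stub B2 by name: `stub_spreadCofactorReduction ⟺ ExpDivisionHard(NN)`
(`spreadCofactorReduction_iff_expDivisionHard`), the `2^{n^{Ω(1)}}` form of the sibling crux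
`NNDivisionHard`.  With Strassen's division elimination (Literature
`DivisionElimination.complexity_le_pow_four_of_mul_eq`, landed by this hand) the exponential
placement follows exactly as the quasi-polynomial one (`Theorems/FifoMatchingNNDivisionHardOfGeneralHardness.lean`, not imported):

* `log_complexity_le_of_certificate` — for every nonzero cofactor `h ≥ 0`,
  `log₂ L_ℂ(NN_n) ≤ 4 · (log₂ (L₊(NN_n·h) + L₊(h)) + 2 log₂ n + 7)`;
* `expDivisionHard_of_expHard` — if `NN_n` needs complex circuits of size `≥ 2^{n^{1/r}}` eventually
  (`n ≤ (log₂ L_ℂ(NN_n))^r` for `n ≥ n₀`), then `ExpDivisionHard(NN)` with exponent `2r`;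
* `spreadCofactorReduction_of_expHard` — hence the REGISTERED stub B2, verbatim, from the exponential
  general hardness of `NN` (hypothesis displayed; no stub credit is claimed).

Reading: like 21181, the open stub B2 is not an extra difficulty beside the parent crux — it follows
from the exponential (a.e.) form of "NN is hard for general circuits"; the line's transfer content is
`stub_zeroOneTransfer` alone.  Honest framing: placement only; B2, `NNNotVP`, VP ≠ VNP remain OPEN.
Sorry-free; axioms `propext`, `Classical.choice`, `Quot.sound`.
-/

noncomputable section

-- Sub = Summit single-conjunct layout: the duplicated namespace component is mandated by the tree.
set_option linter.dupNamespace false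

namespace Summit.ValiantsHypothesis.ValiantsHypothesis.Theorems.FifoMatching.NNNotVP.DivisionSplit

open MvPolynomial Finset Literature.Computability.AlgebraicComplexity
open scoped NNReal BigOperators Classical

namespace OfGeneralExpHardness

/-- `x + y ≤ x * y` for `x, y ≥ 2`. [folklore] -/
theorem add_le_mul_of_two_le {x y : ℕ} (hx : 2 ≤ x) (hy : 2 ≤ y) : x + y ≤ x * y := by nlinarith

/-- **The certificate bounds the complex complexity of `NN_n`, logarithmically**: for every
nonzero cofactor `h ≥ 0`, `log₂ L_ℂ(NN_n) ≤ 4 (log₂ (L₊(NN_n·h) + L₊(h)) + 2 log₂ n + 7)`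
(Strassen's division elimination after transporting the certificate to `ℂ`). [folklore] -/
theorem log_complexity_le_of_certificate (n : ℕ) (h : MvPolynomial (σ n) ℝ≥0) (hh : h ≠ 0) :
    Nat.log 2 (complexity (nestFreeMatchingPoly n ℂ)) ≤
      4 * (Nat.log 2 (complexity (NN n * h) + complexity h) + 2 * Nat.log 2 n + 7) := by
  set Q : ℕ := complexity (NN n * h) + complexity h with hQ
  set b : ℕ := Nat.log 2 Q with hb
  set L : ℕ := Nat.log 2 n with hL
  -- transport to `ℂ` and remove the division
  set φ : ℝ≥0 →+* ℂ := Complex.ofRealHom.comp NNReal.toRealHom with hφ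
  have hφinj : Function.Injective φ := by
    intro x y hxy
    have h1 : ((x : ℝ) : ℂ) = ((y : ℝ) : ℂ) := hxy
    exact_mod_cast h1
  have hmaph : MvPolynomial.map φ h ≠ 0 := by
    intro h0
    apply hh
    apply MvPolynomial.map_injective φ hφinj
    rw [h0, map_zero]
  have hprod : nestFreeMatchingPoly n ℂ * MvPolynomial.map φ h =
      MvPolynomial.map φ (NN n * h) := by
    rw [map_mul, map_nestFreeMatchingPoly]
  have hdeg : (nestFreeMatchingPoly n ℂ).totalDegree ≤ n := totalDegree_nestFreeMatchingPoly_le n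
  have hS := DivisionElimination.complexity_le_pow_four_of_mul_eq hprod hmaph hdeg
  have c1 : complexity (MvPolynomial.map φ (NN n * h)) ≤ complexity (NN n * h) :=
    ArithCircuit.complexity_map_le φ _
  have c2 : complexity (MvPolynomial.map φ h) ≤ complexity h := ArithCircuit.complexity_map_le φ _
  have hcard : Fintype.card (Fin (2 * n) × Fin (2 * n)) = 2 * n * (2 * n) := by
    rw [Fintype.card_prod, Fintype.card_fin]
  rw [hcard] at hS
  -- the base of the fourth power is at most `2^(b+1) · 2^(2L+6)`
  have hQlt : Q < 2 ^ (b + 1) := Nat.lt_pow_succ_log_self one_lt_two Q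
  have hP : n + 2 * n * (2 * n) + 4 ≤ 2 ^ (2 * L + 6) := by
    -- `n < 2^(L+1)` (as in `…NNDivisionHard.OfGeneralHardness.poly_le_two_pow`, re-derived to stay
    -- inside this file's import cone)
    have hn : n < 2 ^ (L + 1) := Nat.lt_pow_succ_log_self one_lt_two n
    have hX1 : 1 ≤ 2 ^ (L + 1) := Nat.one_le_two_pow
    have e1 : n + 2 * n * (2 * n) + 4 ≤ 9 * (2 ^ (L + 1)) ^ 2 := by nlinarith
    have e2 : 9 * (2 ^ (L + 1)) ^ 2 ≤ 16 * (2 ^ (L + 1)) ^ 2 := by nlinarith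
    have e3 : 16 * (2 ^ (L + 1)) ^ 2 = 2 ^ (2 * L + 6) := by
      rw [← pow_mul, show (16 : ℕ) = 2 ^ 4 by norm_num, ← pow_add]
      congr 1; ring
    omega
  have h2b : 2 ≤ 2 ^ (b + 1) := by
    calc (2 : ℕ) = 2 ^ 1 := by norm_num
      _ ≤ 2 ^ (b + 1) := Nat.pow_le_pow_right (by norm_num) (by omega)
  have h2P : 2 ≤ 2 ^ (2 * L + 6) := by
    calc (2 : ℕ) = 2 ^ 1 := by norm_num
      _ ≤ 2 ^ (2 * L + 6) := Nat.pow_le_pow_right (by norm_num) (by omega)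
  have hbase : complexity (MvPolynomial.map φ (NN n * h)) + complexity (MvPolynomial.map φ h) + n +
      2 * n * (2 * n) + 4 ≤ 2 ^ (b + 1 + (2 * L + 6)) := by
    have e1 : complexity (MvPolynomial.map φ (NN n * h)) + complexity (MvPolynomial.map φ h) + n +
        2 * n * (2 * n) + 4 ≤ 2 ^ (b + 1) + 2 ^ (2 * L + 6) := by omega
    refine e1.trans ((add_le_mul_of_two_le h2b h2P).trans (le_of_eq ?_))
    rw [← pow_add]
  have hC : complexity (nestFreeMatchingPoly n ℂ) ≤ 2 ^ (4 * (b + 2 * L + 7)) := by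
    refine hS.trans ((Nat.pow_le_pow_left hbase 4).trans (le_of_eq ?_))
    rw [← pow_mul]
    congr 1
    ring
  calc Nat.log 2 (complexity (nestFreeMatchingPoly n ℂ))
      ≤ Nat.log 2 (2 ^ (4 * (b + 2 * L + 7))) := Nat.log_mono_right hC
    _ = 4 * (b + 2 * L + 7) := Nat.log_pow (by norm_num) _

/-- **Exponential general hardness of `NN` implies its exponential division hardness**:
if `n ≤ (log₂ L_ℂ(NN_n))^r` for all `n ≥ n₀` (circuits of size `≥ 2^{n^{1/r}}`), then for all large
`n` every nonzero cofactor `h ≥ 0` has `n ≤ (log₂ (L₊(NN_n·h) + L₊(h)))^{2r}`. [folklore] -/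
theorem expDivisionHard_of_expHard
    (H : ∃ r n₀ : ℕ, ∀ n ≥ n₀, n ≤ (Nat.log 2 (complexity (nestFreeMatchingPoly n ℂ))) ^ r) :
    ∃ r n₀ : ℕ, ∀ n ≥ n₀, ∀ h : MvPolynomial (σ n) ℝ≥0, h ≠ 0 →
      n ≤ (Nat.log 2 (complexity (NN n * h) + complexity h)) ^ r := by
  obtain ⟨r, n₀, hr⟩ := H
  obtain ⟨n₂, hn₂⟩ := eventually_polylog_lt 47 (2 * r)
  refine ⟨2 * r, max n₀ n₂, fun n hn h hh => ?_⟩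
  have hn0 : n₀ ≤ n := le_trans (le_max_left _ _) hn
  have hn2 : n₂ ≤ n := le_trans (le_max_right _ _) hn
  set b : ℕ := Nat.log 2 (complexity (NN n * h) + complexity h) with hb
  set L : ℕ := Nat.log 2 n with hL
  have h1 : n ≤ (4 * (b + 2 * L + 7)) ^ r :=
    (hr n hn0).trans (Nat.pow_le_pow_left (log_complexity_le_of_certificate n h hh) r)
  by_cases hbs : b ≤ L + 47
  · -- small certificate exponent: `n ≤ (2L + 47)^(2r) < n`
    exfalso
    have hsq : 4 * (b + 2 * L + 7) ≤ (2 * L + 47) ^ 2 := by nlinarith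
    have h2 : n ≤ (2 * L + 47) ^ (2 * r) :=
      calc n ≤ (4 * (b + 2 * L + 7)) ^ r := h1
        _ ≤ ((2 * L + 47) ^ 2) ^ r := Nat.pow_le_pow_left hsq r
        _ = (2 * L + 47) ^ (2 * r) := by rw [← pow_mul]
    exact absurd (hn₂ n hn2) (not_lt.2 h2)
  · -- large certificate exponent: `4(b + 2L + 7) ≤ b²`
    push Not at hbs
    have hsq : 4 * (b + 2 * L + 7) ≤ b ^ 2 := by nlinarith
    calc n ≤ (4 * (b + 2 * L + 7)) ^ r := h1
      _ ≤ (b ^ 2) ^ r := Nat.pow_le_pow_left hsq r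
      _ = b ^ (2 * r) := by rw [← pow_mul]

/-- ★ **The registered stub B2 from the exponential general hardness of `NN`**
(`stub_spreadCofactorReduction` of line `division_split`, conclusion verbatim; hypothesis = the
exponential a.e. form of the parent crux; chain `expDivisionHard_of_expHard` then hand 8's
`spreadCofactorReduction_of_expDivisionHard`).  No stub credit: the hypothesis is open. [folklore] -/
theorem spreadCofactorReduction_of_expHard
    (H : ∃ r n₀ : ℕ, ∀ n ≥ n₀, n ≤ (Nat.log 2 (complexity (nestFreeMatchingPoly n ℂ))) ^ r) :
    ∃ k : ℕ, ∀ (n : ℕ) (h : MvPolynomial (σ n) ℝ≥0), h ≠ 0 →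
      ∃ h' : MvPolynomial (σ n) ℝ≥0, (∃ m ∈ h'.support, m.support.card ≤ (Nat.log 2 n + k) ^ k) ∧
        complexity (NN n * h') ≤
          2 ^ ((Nat.log 2 n + Nat.log 2 (complexity (NN n * h) + complexity h) + k) ^ k) :=
  SpreadCofactorExpType.spreadCofactorReduction_of_expDivisionHard (expDivisionHard_of_expHard H)

end OfGeneralExpHardness

end Summit.ValiantsHypothesis.ValiantsHypothesis.Theorems.FifoMatching.NNNotVP.DivisionSplit

end
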